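import Literature.AnabelianGeometry.SemiGraphs.TemperedCurveOfOpenSubgroupCompact
import Literature.AnabelianGeometry.SemiGraphs.TemperedDecompositionCompact
import Literature.AnabelianGeometry.SemiGraphs.TemperedCurveBridge
import HarnessLib

/-!
# `X_H → X_K`: the parameter bundle `GroupLevelData` passes to the covering (same base field)

Mochizuki, *Semi-graphs of anabelioids*, Publ. RIMS **42** (2006), Example 3.10 pp. 43–45 ("`π₁^temp(X_K)` is a tempered
topological group"; temp-slimness), §6 p. 69. [cite: MochizukiSemiAnbd2006, Ex 3.10 pp.43-45]
DEF-BEARING companion (abc-iut cell; staged by abc-iut-L6-t7 gen 3 with B15 piece 1; post-freeze def): for an open subgroup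
`H ≤ Π^temp_{X_K}` of finite index with the SAME base field (`aug(H) = G_K`, the case of `X̲_v → X_v`), abc-iut-L3's parameter
bundle `GroupLevelData` of `X` ("`Π`, `Δ` tempered and temp-slim, `Π` Galois-countable, `G_K ≃ Gal(K̄/K)`") INDUCES that of the
covering `X.ofOpenSubgroup H … X.K …`: temperedness of the closed subgroups `H`, `H ∩ Δ` (abc-iut-L3
`IsTempered.subgroup_of_isClosed`), temp-slimness of open subgroups of temp-slim groups, second countability of subspaces, and
the same `galEquiv`.  So abc-iut-L5's GENUINE [IUTchI] §2 datum `StableCurveTemperedData.ofSpecialFibre` of `X̲_v` needs no new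
group-level binder beyond `X`'s own.  Classical; nothing of [IUTchIII] is touched.
-/

noncomputable section

namespace Literature.AnabelianGeometry.SemiGraphs

open _root_.Topology
open Literature.AlgebraicGeometry.Frobenioids (IsSlimGroup)

/-! ### Temp-slimness passes to open subgroups and along topological isomorphisms -/

section Slim

variable {G : Type*} [Group G] [TopologicalSpace G]

/-- An OPEN subgroup of a temp-slim group is temp-slim (its open subgroups are open in the ambient group, and centralisers
only shrink). Private local copy of the tree's `SemiGraphs.isSlimGroup_subgroup_of_isOpen` (OncePuncturedTemperedGroupWitness, p422340) /
`IsSlimGroup.subgroup_of_isOpen` (AbsTopIChainsRemark422, p432891), whose import chains ([EtTh]/[IUTchI] resp. [AbsTopI] modules) are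
not wanted in this [SemiAnbd]-level file. [folklore] -/
private theorem slim_openSubgroup_aux (hG : IsSlimGroup G) (H : Subgroup G) (hH : IsOpen (H : Set G)) :
    IsSlimGroup H := by
  refine ⟨fun U hU => ?_⟩
  -- `U ≤ H` open in `H` ⇒ its image is open in `G`
  have hUo : IsOpen ((U.map H.subtype : Subgroup G) : Set G) := by
    rw [Subgroup.coe_map]
    exact hH.isOpenEmbedding_subtypeVal.isOpenMap _ hU
  have hZ := hG.centralizer_eq_bot _ hUo
  rw [eq_bot_iff]
  intro z hz
  rw [Subgroup.mem_bot]
  have hz' : (z : G) ∈ Subgroup.centralizer ((U.map H.subtype : Subgroup G) : Set G) := by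
    rw [Subgroup.mem_centralizer_iff]
    rintro _ ⟨u, hu, rfl⟩
    have := Subgroup.mem_centralizer_iff.mp hz u hu
    exact congrArg Subtype.val this
  rw [hZ, Subgroup.mem_bot] at hz'
  exact Subtype.ext hz'

/-- Temp-slimness is invariant under isomorphisms of topological groups — private local copy of abc-iut-L4's
`isSlimGroup_of_continuousMulEquiv` (SlimTransport.lean), to keep the imports [SemiAnbd]-level. [folklore] -/
private theorem slim_transport_aux {G' : Type*} [Group G'] [TopologicalSpace G'] (e : G ≃ₜ* G')
    (hG : IsSlimGroup G) : IsSlimGroup G' := by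
  refine ⟨fun U hU => ?_⟩
  have hUo : IsOpen ((U.comap e.toMulEquiv.toMonoidHom : Subgroup G) : Set G) := hU.preimage e.continuous
  have hZ := hG.centralizer_eq_bot _ hUo
  rw [eq_bot_iff]
  intro z hz
  rw [Subgroup.mem_bot]
  have hz' : e.symm z ∈ Subgroup.centralizer ((U.comap e.toMulEquiv.toMonoidHom : Subgroup G) : Set G) := by
    rw [Subgroup.mem_centralizer_iff]
    intro g hg
    have hge : e g ∈ U := hg
    have := Subgroup.mem_centralizer_iff.mp hz (e g) hge
    apply e.injective
    simpa [map_mul] using this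
  rw [hZ, Subgroup.mem_bot] at hz'
  simpa using congrArg e hz'

end Slim

namespace TemperedCurve

variable {p : ℕ} [Fact p.Prime] (X : TemperedCurve p) (H : Subgroup X.PiTemp)
  (hHo : IsOpen (H : Set X.PiTemp)) [H.FiniteIndex]
  (hK : (X.aug.toMonoidHom.comp H.subtype).range = X.K.fixingSubgroup)
  (hDopen : ∀ (x : X.Pt) (g : X.PiTemp), IsOpen (X.aug '' ((X.decompOfOpenAt H x g).map H.subtype : Set X.PiTemp)))

/-- For the covering with the SAME base field, `G_{K'} = G_K` (`rfl`). [cite: MochizukiSemiAnbd2006, §6 p.69] -/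
theorem ofOpenSubgroup_GK [FiniteDimensional ℚ_[p] X.K] :
    (X.ofOpenSubgroup H hHo X.K hK hDopen).GK = X.GK := rfl

/-- The kernel of `augK` on the covering is `H ∩ Δ^temp_X` read in `H`. [cite: MochizukiSemiAnbd2006, §6 p.69] -/
theorem ofOpenSubgroup_ker_augK [FiniteDimensional ℚ_[p] X.K] (ι : X.GK ≃ₜ* Field.absoluteGaloisGroup X.K) :
    ((X.ofOpenSubgroup H hHo X.K hK hDopen).augK ι).toMonoidHom.ker = (X.augK ι).toMonoidHom.ker.comap H.subtype := by
  rw [TemperedCurve.ker_augK, TemperedCurve.ker_augK, ofOpenSubgroup_DeltaTemp]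

/-- `H ∩ Δ^temp_X` (in `H`) `≃ₜ*` the open subgroup `H ∩ Δ` of `Δ^temp_X` (in `Δ`). [cite: MochizukiSemiAnbd2006, §6 p.69] -/
def deltaOfOpenEquiv :
    ↥(X.DeltaTemp.comap H.subtype) ≃ₜ* ↥(H.subgroupOf X.DeltaTemp) :=
  { toFun := fun a => ⟨⟨((a : H) : X.PiTemp), a.2⟩, (a : H).2⟩
    invFun := fun b => ⟨⟨((b : X.DeltaTemp) : X.PiTemp), b.2⟩, (b : X.DeltaTemp).2⟩
    left_inv := fun a => by ext; rfl
    right_inv := fun b => by ext; rfl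
    map_mul' := fun a b => by ext; rfl
    continuous_toFun := by
      apply Continuous.subtype_mk; apply Continuous.subtype_mk
      exact continuous_subtype_val.comp continuous_subtype_val
    continuous_invFun := by
      apply Continuous.subtype_mk; apply Continuous.subtype_mk
      exact continuous_subtype_val.comp continuous_subtype_val }

/-- **`GroupLevelData` of the covering from that of `X`** (same base field): `Π^temp_{X_H} = H` and `Δ^temp_{X_H} = H ∩ Δ^temp_X`
are CLOSED subgroups of tempered groups, hence tempered (abc-iut-L3 `IsTempered.subgroup_of_isClosed`); OPEN subgroups of temp-slim
groups, hence temp-slim; subspaces of a second-countable space; `galEquiv` unchanged. [cite: MochizukiSemiAnbd2006, Ex 3.10 pp.43-45] -/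
def GroupLevelData.ofOpenSubgroup [FiniteDimensional ℚ_[p] X.K] (d : X.GroupLevelData) :
    (X.ofOpenSubgroup H hHo X.K hK hDopen).GroupLevelData where
  galEquiv := d.galEquiv
  isTempered := d.isTempered.subgroup_of_isClosed H (Subgroup.isClosed_of_isOpen H hHo)
  isTempered_ker := by
    rw [ofOpenSubgroup_ker_augK]
    haveI : IsTopologicalGroup ↥H := inferInstance
    refine (d.isTempered.subgroup_of_isClosed H (Subgroup.isClosed_of_isOpen H hHo)).subgroup_of_isClosed _ ?_
    -- `H ∩ Δ` is closed in `H` (preimage of the closed `Δ = ker augK`)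
    have hc : IsClosed (((X.augK d.galEquiv).toMonoidHom.ker : Subgroup X.PiTemp) : Set X.PiTemp) := by
      rw [MonoidHom.coe_ker]
      exact isClosed_singleton.preimage (X.augK d.galEquiv).continuous
    exact hc.preimage continuous_subtype_val
  isSlimGroup := slim_openSubgroup_aux d.isSlimGroup H hHo
  isSlimGroup_ker := by
    rw [ofOpenSubgroup_ker_augK, TemperedCurve.ker_augK]
    -- `H ∩ Δ` is open in the temp-slim `Δ`, then transport along `deltaOfOpenEquiv`
    have hΔ : IsSlimGroup X.DeltaTemp := by
      have := d.isSlimGroup_ker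
      rwa [TemperedCurve.ker_augK] at this
    have hopen : IsOpen ((H.subgroupOf X.DeltaTemp : Subgroup X.DeltaTemp) : Set X.DeltaTemp) :=
      hHo.preimage continuous_subtype_val
    exact slim_transport_aux (X.deltaOfOpenEquiv H).symm (slim_openSubgroup_aux hΔ _ hopen)
  secondCountableTopology := by
    haveI := d.secondCountableTopology
    exact TopologicalSpace.Subtype.secondCountableTopology (H : Set X.PiTemp)

end TemperedCurve

end Literature.AnabelianGeometry.SemiGraphs

end
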